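import Literature.Probability.RandomPlanarGeometry.HexSAWStripAmplitudeRatioWidthTwo
import Mathlib.Analysis.Calculus.Deriv.Pow
import Mathlib.Analysis.Calculus.Deriv.Mul
import Mathlib.Analysis.Calculus.Deriv.Add
import Mathlib.Analysis.Normed.Group.Tannery
import HarnessLib

/-!
# The mean number of surface contacts per step of a long critical strip bridge: the derived renewal equation, the sandwich
# `Ĉ_D = (1 + D_T) Ĉ_M (1 + D_T)`, and the renewal–reward law `θ_T = ⟨contacts⟩/⟨steps⟩` (module «CONTACT-DENSITY»)

Topic `Literature/Probability/RandomPlanarGeometry` (continues «AMPLITUDE-RATIO» `HexSAWStripAmplitudeRatio.lean` and, for §7 only, its width-two corollary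
«AMPLITUDE-RATIO-WIDTH-TWO» `HexSAWStripAmplitudeRatioWidthTwo.lean` (`HV.widthTwo_meanContacts_per_step`) — the explicit length residue
`HV.tendsto_stripLenD_residue_explicit` `(1 − s)D_T(s)_{ab} → u_aℓ_b/⟨ℓ, M̄_len u⟩`, the fixed vectors `HV.exists_pos_fixed_vectors_Iinf_stripYT`, the
headline `HV.lengthAmplitude_mul_meanSteps_eq`; «BRIDGE-LENGTH-RENEWAL» `HexSAWStripBridgeLengthRenewal.lean` — the exact renewal equation in length
`HV.LUM_ren : D(n) = M(n) + Σ_{i+j=n} M(i)D(j)` valid at EVERY surface fugacity `y ≥ 0`, `HV.summable_LUM_LMM_mul_pow`; «LENGTH-NEUMANN»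
`HexSAWStripBridgeLengthResidue.lean` — `HV.stripLenI/stripLenD`, `HV.neumannSum_stripLenI_eq`, `HV.summable_length_mul_LMM`; the slices `HV.LUs/LMs`
(`HexSAWStripBridgeLengthPointwise.lean`) as FINITE sums of the monomials `HV.wD T y l = x_c^{|l|−1} y^{#top(l.tail)}`; the irreducible contact
coefficients `HV.irCoeffN/irCoeff` and `HV.Imat_eq_sum_irCoeffN` (`HexSAWStripIrreducibleBridgeMean.lean`), `HV.Imat_eq_sum_range_LMM`).
Lane «pcv-sawmu» (CriticalPhenomena venture), a-p2 g23.  Sources of the SETTING: W. Feller I (1968) XIII.11 (renewal with rewards / the mean);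
E. Seneta (1973) §6.1 (the resolvent series), §6.2 Theorem 6.4 (finite derivative at the convergence parameter); H. Duminil-Copin, A. Hammond,
CMP 324 (2013) §2.2 (unique decomposition of a bridge into irreducible bridges); N. R. Beaton et al., CMP 326 (2014) Corollary 8 (arXiv v5 p. 12:
the strip at `(x_c, y_T)`).  Nothing of the kind is printed for the strip.

THE POINT.  «AMPLITUDE-RATIO» found `Λℓ_T/(2Λ_T) = y_T⟨ℓ, M̄_top u⟩/⟨ℓ, M̄_len u⟩`, a quotient of first moments of ONE irreducible piece.  Here
that quotient gets its meaning for WHOLE bridges: it is the asymptotic number of surface contacts per step of a long critical bridge.  No new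
combinatorics is needed: the number of contacts is additive over the irreducible pieces, which is exactly what differentiating the tree's
renewal equation `LUM_ren` in the surface fugacity `y` says (both sides are polynomials in `y`).

## What is proved (namespace `Literature.Probability.RandomPlanarGeometry.SAW.HV`; `y_T = stripYT T`, `T ≥ 2` unless stated; no new definitions —
## the contact-weighted slices are written out: `C_D(n)_{ab}(y) = Σ_{l ∈ LUset T n n a b} #top(l.tail) · wD T y l`, `C_M(n)` over `LMset`;
## `Ĉ_D(s) = Σ_n C_D(n)(y_T) s^n`, `Ĉ_M(s)` likewise; `C̄_M = Ĉ_M(1) = Σ_n C_M(n)(y_T)`; `M̄_len`, `M̄_top` as in «AMPLITUDE-RATIO»)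

* §1 `hasDerivAt_LUs`, `hasDerivAt_LMs`, `mul_derivSum_eq_contactSum` — `y ∂_y Σ wD = Σ #top · wD` (finite sums of monomials).
* §2 ★★ `contact_ren` — THE DERIVED RENEWAL EQUATION at every `y > 0`: `C_D(n) = C_M(n) + Σ_{i+j=n} (C_M(i) D(j) + M(i) C_D(j))` (Leibniz on `LUM_ren`,
  uniqueness of the derivative).
* §3 `contactSlice_le` (`0 ≤ C_D(n) ≤ n D(n)`, `0 ≤ C_M(n) ≤ n M(n)`), `summable_contactSlices` (at `y_T`: `Σ_n C_D(n)s^n`, `Σ_n C_M(n)s^n < ∞` on `[0,1)`,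
  and `Σ_n C_M(n) < ∞` — finite mean length).
* §4 ★★ `contactGF_ren` — `Ĉ_D(s) = Ĉ_M(s) + Ĉ_M(s)D_T(s) + I_T(s)Ĉ_D(s)`; ★★ `contactGF_eq_sandwich` — `Ĉ_D(s) = (1 + D_T(s)) Ĉ_M(s) (1 + D_T(s))`
  (the derivative of `(1 − I)⁻¹`).
* §5 `tendsto_contactGF_irr` (`Ĉ_M(s) → C̄_M`), `tendsto_one_sub_mul_one_add_stripLenD` (`(1 − s)(1 + D_T(s)) → uℓᵀ/⟨ℓ, M̄_len u⟩`);
  ★★★ `tendsto_sq_mul_contactGF` — `(1 − s)² Ĉ_D(s)_{ab} → u_aℓ_b⟨ℓ, C̄_M u⟩/⟨ℓ, M̄_len u⟩²` (a DOUBLE pole with explicit rank-one coefficient);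
  ★★★★ `tendsto_contacts_per_step` — `(1 − s)Ĉ_D(s)_{ab}/D_T(s)_{ab} → θ_T = ⟨ℓ, C̄_M u⟩/⟨ℓ, M̄_len u⟩` for EVERY pair of levels: the Abel-mean number of
  surface contacts per step of a long critical bridge equals (mean contacts)/(mean steps) of one irreducible piece under the invariant
  weighting — the renewal–reward theorem for the strip.
* §6 ★★ `tsum_contactIrr_eq` — `C̄_M = y_T · M̄_top` entrywise (one first moment, two gradings, through `y ∂_y Imat T N y` and `N → ∞`);
  `contactMoment_dotProduct_eq` (`θ_T = y_T κ_T`); ★★★ `lengthAmplitude_mul_eq_two_mul_contactAmplitude_mul_theta` — `Λℓ·⟨ℓ, M̄_len u⟩ = 2Λ·⟨ℓ, C̄_M u⟩`,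
  i.e. `Λℓ_T/(2Λ_T) = θ_T`: the amplitude ratio of «AMPLITUDE-RATIO» IS the contact density of long critical bridges.
* §7 ★★★ `exists_contactDensity` — vector-free: ONE number `θ_T > 0` with `(1 − s)Ĉ_D(s)_{ab}/D_T(s)_{ab} → θ_T` for every `a, b` and `Λℓ = 2Λ θ_T`;
  ★★★ `widthTwo_contacts_per_step` — `T = 2`: `(1 − s)Ĉ_D(s)_{ab}/D_2(s)_{ab} → (3 − √2)/4 = 0.39644…` for every pair of levels (no hypotheses).

Label: LANE THEOREM (own result of lane «pcv-sawmu», a-p2 g23, 2026-08-27); classical template = renewal–reward / Markov renewal theory.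
NOT claimed: a POINTWISE law `c̄(n)/n → θ_T` for the mean contact number at fixed length `n` (only the Abelian form is proved; the pointwise
form would follow from the period-two matrix renewal theorem applied to `C_D`, not done), concentration / a law of large numbers for the contact
fraction of a single long bridge, `T = 1`, anything about β-walks' own contact density (heads and tails are not negligible there without a
separate argument), rates.
-/

noncomputable section

open Finset Filter Topology Matrix Literature.Probability.LatticeModels Literature.Probability.Percolation
  Literature.Analysis.Matrix

namespace Literature.Probability.RandomPlanarGeometry.SAW

namespace HV

variable {T : ℕ}

/-! ### §1 Differentiating the slices in the surface fugacity: `y ∂_y Σ wD = Σ topCnt · wD` -/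

section Deriv

variable {N : ℕ} {σ : ℤ} {a b : ℤ} {y : ℝ}

/-- `k · y^{k−1} · y = k · y^k` for every natural `k` (the `k = 0` case is `0 = 0`; plumbing). [folklore] -/
private theorem natMul_pow_pred_mul (k : ℕ) (y : ℝ) : (k : ℝ) * y ^ (k - 1) * y = (k : ℝ) * y ^ k := by
  rcases k with _ | k
  · simp
  · rw [Nat.add_sub_cancel, mul_assoc, ← pow_succ]

/-- The slice `U_σ(a,b)(y) = Σ_{l} x_c^{|l|−1} y^{#top(l.tail)}` is differentiable in `y` with derivative
`Σ_{l} x_c^{|l|−1} · #top · y^{#top−1}` (a finite sum of monomials; plumbing). [cite: DuminilCopinHammond2013, §2.2; lane plumbing a-p2 g23] -/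
theorem hasDerivAt_LUs (N : ℕ) (σ a b : ℤ) (y : ℝ) :
    HasDerivAt (fun y => LUs T N σ a b y)
      (∑ l ∈ LUset T N σ a b, hexCriticalFugacity ^ (l.length - 1) * ((topCnt T l.tail : ℝ) * y ^ (topCnt T l.tail - 1))) y := by
  unfold LUs wD
  exact HasDerivAt.fun_sum fun l _ => (hasDerivAt_pow _ y).const_mul _

/-- The irreducible slice `M_σ(a,b)(y)` is differentiable in `y` likewise (plumbing). [cite: DuminilCopinHammond2013, §2.2; lane plumbing a-p2 g23] -/
theorem hasDerivAt_LMs (N : ℕ) (σ a b : ℤ) (y : ℝ) :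
    HasDerivAt (fun y => LMs T N σ a b y)
      (∑ l ∈ LMset T N σ a b, hexCriticalFugacity ^ (l.length - 1) * ((topCnt T l.tail : ℝ) * y ^ (topCnt T l.tail - 1))) y := by
  unfold LMs wD
  exact HasDerivAt.fun_sum fun l _ => (hasDerivAt_pow _ y).const_mul _

/-- `y · ∂_y U = Σ_l #top(l.tail) · wD(l)`: the contact-weighted slice (plumbing). [cite: DuminilCopinHammond2013, §2.2; lane plumbing a-p2 g23] -/
theorem mul_derivSum_eq_contactSum (S : Finset (List HV)) (y : ℝ) :
    y * ∑ l ∈ S, hexCriticalFugacity ^ (l.length - 1) * ((topCnt T l.tail : ℝ) * y ^ (topCnt T l.tail - 1)) =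
      ∑ l ∈ S, (topCnt T l.tail : ℝ) * wD T y l := by
  rw [mul_sum]
  refine sum_congr rfl fun l _ => ?_
  unfold wD
  calc y * (hexCriticalFugacity ^ (l.length - 1) * ((topCnt T l.tail : ℝ) * y ^ (topCnt T l.tail - 1)))
      = hexCriticalFugacity ^ (l.length - 1) * ((topCnt T l.tail : ℝ) * y ^ (topCnt T l.tail - 1) * y) := by ring
    _ = _ := by rw [natMul_pow_pred_mul]; ring

end Deriv

/-! ### §2 The derived renewal equation: contacts split additively over the first irreducible piece -/

section DerivedRenewal

/-- ★★ **THE DERIVED RENEWAL EQUATION (Leibniz form).**  For `y > 0`, every `n` and all levels `a, b`, with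
`C_D(n)_{ab}(y) := Σ_{bridges a→b, n steps} #top · x_c^n y^{#top}` and `C_M(n)` the same over irreducible bridges,
`C_D(n)_{ab} = C_M(n)_{ab} + Σ_{i+j=n} Σ_c ( C_M(i)_{ac} D(j)_{cb} + M(i)_{ac} C_D(j)_{cb} )` —
obtained by applying `y ∂_y` to the tree's exact renewal equation `D(n) = M(n) + Σ_{i+j=n} M(i) D(j)` (`LUM_ren`, an identity of
polynomials in `y` on `[0, ∞)`): the number of surface contacts of a bridge is the sum over its irreducible pieces.
[cite: DuminilCopinHammond2013, §2.2 (unique decomposition into irreducible bridges); Feller1968, XIII.3; lane «pcv-sawmu» a-p2 g23 — own] -/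
theorem contact_ren {y : ℝ} (hy : 0 < y) (n : ℕ) (a b : Fin (2 * T)) :
    (∑ l ∈ LUset T n (n : ℤ) (a : ℕ) (b : ℕ), (topCnt T l.tail : ℝ) * wD T y l) =
      (∑ l ∈ LMset T n (n : ℤ) (a : ℕ) (b : ℕ), (topCnt T l.tail : ℝ) * wD T y l) +
        ∑ p ∈ antidiagonal n, ∑ c : Fin (2 * T),
          ((∑ l ∈ LMset T p.1 (p.1 : ℤ) (a : ℕ) (c : ℕ), (topCnt T l.tail : ℝ) * wD T y l) * LUM T p.2 (p.2 : ℤ) y c b +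
            LMM T p.1 (p.1 : ℤ) y a c * ∑ l ∈ LUset T p.2 (p.2 : ℤ) (c : ℕ) (b : ℕ), (topCnt T l.tail : ℝ) * wD T y l) := by
  -- derivative sums
  set dU : ℕ → ℤ → ℤ → ℝ → ℝ := fun N c d y =>
    ∑ l ∈ LUset T N (N : ℤ) c d, hexCriticalFugacity ^ (l.length - 1) * ((topCnt T l.tail : ℝ) * y ^ (topCnt T l.tail - 1)) with hdU
  set dM : ℕ → ℤ → ℤ → ℝ → ℝ := fun N c d y =>
    ∑ l ∈ LMset T N (N : ℤ) c d, hexCriticalFugacity ^ (l.length - 1) * ((topCnt T l.tail : ℝ) * y ^ (topCnt T l.tail - 1)) with hdM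
  -- the two sides of `LUM_ren` as functions of `y`, with their derivatives
  have hF : HasDerivAt (fun y => LUM T n (n : ℤ) y a b) (dU n (a : ℕ) (b : ℕ) y) y := hasDerivAt_LUs n n _ _ y
  have hG : HasDerivAt (fun y => LMM T n (n : ℤ) y a b + ∑ p ∈ antidiagonal n, ∑ c : Fin (2 * T),
      LMM T p.1 (p.1 : ℤ) y a c * LUM T p.2 (p.2 : ℤ) y c b)
      (dM n (a : ℕ) (b : ℕ) y + ∑ p ∈ antidiagonal n, ∑ c : Fin (2 * T),
        (dM p.1 (a : ℕ) (c : ℕ) y * LUM T p.2 (p.2 : ℤ) y c b + LMM T p.1 (p.1 : ℤ) y a c * dU p.2 (c : ℕ) (b : ℕ) y)) y := by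
    refine (hasDerivAt_LMs n n _ _ y).add (HasDerivAt.fun_sum fun p _ => HasDerivAt.fun_sum fun c _ => ?_)
    exact (hasDerivAt_LMs (T := T) p.1 p.1 (a : ℕ) (c : ℕ) y).fun_mul (hasDerivAt_LUs (T := T) p.2 p.2 (c : ℕ) (b : ℕ) y)
  -- the two functions agree near `y > 0`
  have hFG : (fun y => LMM T n (n : ℤ) y a b + ∑ p ∈ antidiagonal n, ∑ c : Fin (2 * T),
      LMM T p.1 (p.1 : ℤ) y a c * LUM T p.2 (p.2 : ℤ) y c b) =ᶠ[𝓝 y] (fun y => LUM T n (n : ℤ) y a b) := by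
    filter_upwards [Ioi_mem_nhds hy] with y' hy'
    have h := congr_fun (congr_fun (LUM_ren (T := T) (le_of_lt hy') n) a) b
    rw [Matrix.add_apply, Matrix.sum_apply] at h
    rw [h]
    simp only [Matrix.mul_apply]
  have huniq := hF.unique (hG.congr_of_eventuallyEq hFG.symm)
  -- multiply by `y` and convert derivative sums to contact sums
  have hU : ∀ N (c d : ℤ), y * dU N c d y = ∑ l ∈ LUset T N (N : ℤ) c d, (topCnt T l.tail : ℝ) * wD T y l :=
    fun N c d => mul_derivSum_eq_contactSum _ y
  have hM : ∀ N (c d : ℤ), y * dM N c d y = ∑ l ∈ LMset T N (N : ℤ) c d, (topCnt T l.tail : ℝ) * wD T y l :=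
    fun N c d => mul_derivSum_eq_contactSum _ y
  rw [← hU, ← hM, huniq, mul_add]
  congr 1
  rw [Finset.mul_sum (antidiagonal n)]
  refine sum_congr rfl fun p _ => ?_
  rw [Finset.mul_sum Finset.univ]
  refine sum_congr rfl fun c _ => ?_
  rw [← hU, ← hM]
  ring

end DerivedRenewal

/-! ### §3 The contact-weighted slices at the threshold: bounds, summability, generating functions -/

section Slices

variable {n : ℕ}

/-- `0 ≤ C_D(n)_{ab} ≤ n · D(n)_{ab}` and `0 ≤ C_M(n)_{ab} ≤ n · M(n)_{ab}` at any `y ≥ 0`: a bridge with `n` steps has at most `n`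
surface contacts after its first vertex (plumbing). [cite: DuminilCopinHammond2013, §2.2; lane plumbing a-p2 g23] -/
theorem contactSlice_le {y : ℝ} (hy : 0 ≤ y) (n : ℕ) (a b : Fin (2 * T)) :
    (0 ≤ ∑ l ∈ LUset T n (n : ℤ) (a : ℕ) (b : ℕ), (topCnt T l.tail : ℝ) * wD T y l ∧
      ∑ l ∈ LUset T n (n : ℤ) (a : ℕ) (b : ℕ), (topCnt T l.tail : ℝ) * wD T y l ≤ n * LUM T n (n : ℤ) y a b) ∧
      (0 ≤ ∑ l ∈ LMset T n (n : ℤ) (a : ℕ) (b : ℕ), (topCnt T l.tail : ℝ) * wD T y l ∧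
      ∑ l ∈ LMset T n (n : ℤ) (a : ℕ) (b : ℕ), (topCnt T l.tail : ℝ) * wD T y l ≤ n * LMM T n (n : ℤ) y a b) := by
  have htop : ∀ l : List HV, hlen l = n → (topCnt T l.tail : ℝ) ≤ n := fun l hl => by
    have h1 := topCnt_le_length T l.tail
    have h2 : l.tail.length = n := by rw [List.length_tail]; unfold hlen at hl; omega
    exact_mod_cast h2 ▸ h1
  refine ⟨⟨sum_nonneg fun l _ => mul_nonneg (Nat.cast_nonneg _) (wD_nonneg T hy l), ?_⟩,
    ⟨sum_nonneg fun l _ => mul_nonneg (Nat.cast_nonneg _) (wD_nonneg T hy l), ?_⟩⟩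
  · rw [LUM, LUs, mul_sum]
    exact sum_le_sum fun l hl => mul_le_mul_of_nonneg_right (htop l (of_mem_LUset hl).2.2.2.2.2.2.2.2.2) (wD_nonneg T hy l)
  · rw [LMM, LMs, mul_sum]
    exact sum_le_sum fun l hl => mul_le_mul_of_nonneg_right (htop l (of_mem_LMset hl).2.2.2.2.2.2.2.2.2.2) (wD_nonneg T hy l)

/-- Summability of the contact-weighted generating functions on `[0,1)` at `y_T` and of the irreducible one AT `s = 1` (`T ≥ 2`):
`Σ_n C_D(n) s^n < ∞` (`C_D(n) ≤ nK`), `Σ_n C_M(n) < ∞` (`C_M(n) ≤ n M(n)`, finite mean length). [cite: DuminilCopinHammond2013, §2.2; Seneta1973, §6.2; lane plumbing a-p2 g23] -/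
theorem summable_contactSlices (hT : 2 ≤ T) (a b : Fin (2 * T)) {s : ℝ} (hs0 : 0 ≤ s) (hs1 : s < 1) :
    Summable (fun n : ℕ => (∑ l ∈ LUset T n (n : ℤ) (a : ℕ) (b : ℕ), (topCnt T l.tail : ℝ) * wD T (stripYT T) l) * s ^ n) ∧
      Summable (fun n : ℕ => (∑ l ∈ LMset T n (n : ℤ) (a : ℕ) (b : ℕ), (topCnt T l.tail : ℝ) * wD T (stripYT T) l) * s ^ n) ∧
      Summable (fun n : ℕ => ∑ l ∈ LMset T n (n : ℤ) (a : ℕ) (b : ℕ), (topCnt T l.tail : ℝ) * wD T (stripYT T) l) := by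
  have hT1 : 1 ≤ T := by omega
  have hy := (stripYT_pos hT1).le
  obtain ⟨⟨K, hK⟩, -, -⟩ := summable_LUM_LMM_mul_pow hT1 a b hs0 hs1
  have hb := fun n => contactSlice_le (T := T) hy n a b
  have hK0 : 0 ≤ K := (LMM_LUM_nonneg hy _ a b).2.trans (hK 0)
  -- `Σ n K s^n < ∞`
  have hgeo : Summable fun n : ℕ => (n : ℝ) * K * s ^ n := by
    have := (summable_pow_mul_geometric_of_norm_lt_one 1 (by rwa [Real.norm_eq_abs, abs_of_nonneg hs0] : ‖s‖ < 1)).mul_left K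
    refine this.congr fun n => ?_
    simp; ring
  have h1 : Summable (fun n : ℕ => (∑ l ∈ LUset T n (n : ℤ) (a : ℕ) (b : ℕ), (topCnt T l.tail : ℝ) * wD T (stripYT T) l) * s ^ n) :=
    hgeo.of_nonneg_of_le (fun n => mul_nonneg (hb n).1.1 (pow_nonneg hs0 _)) fun n =>
      mul_le_mul_of_nonneg_right ((hb n).1.2.trans (mul_le_mul_of_nonneg_left (hK n) (Nat.cast_nonneg _))) (pow_nonneg hs0 _)
  have h3 : Summable (fun n : ℕ => ∑ l ∈ LMset T n (n : ℤ) (a : ℕ) (b : ℕ), (topCnt T l.tail : ℝ) * wD T (stripYT T) l) :=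
    (summable_length_mul_LMM hT a b).of_nonneg_of_le (fun n => (hb n).2.1) fun n => (hb n).2.2
  refine ⟨h1, h3.of_nonneg_of_le (fun n => mul_nonneg (hb n).2.1 (pow_nonneg hs0 _)) fun n =>
    mul_le_of_le_one_right (hb n).2.1 (pow_le_one₀ hs0 hs1.le), h3⟩

end Slices

/-! ### §4 Generating functions at `y_T`: `Ĉ_D(s) = Ĉ_M(s) + Ĉ_M(s) D_T(s) + I_T(s) Ĉ_D(s)`, hence `Ĉ_D = (1 + D_T) Ĉ_M (1 + D_T)` -/

section GF

/-- Cauchy product with powers for non-negative summable data (plumbing; Mathlib `Summable.tsum_mul_tsum_eq_tsum_sum_antidiagonal`).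
[cite: Feller1968, XIII.3; lane plumbing] (Kept `private`: statement-twins are private in three tree files.) -/
private theorem tsum_antidiagonal_mul_pow₃ {f g : ℕ → ℝ} (hf : ∀ m, 0 ≤ f m) (hg : ∀ m, 0 ≤ g m) {s : ℝ} (hs : 0 ≤ s)
    (hfs : Summable fun m => f m * s ^ m) (hgs : Summable fun m => g m * s ^ m) :
    (Summable fun m => (∑ p ∈ antidiagonal m, f p.1 * g p.2) * s ^ m) ∧
      ∑' m, (∑ p ∈ antidiagonal m, f p.1 * g p.2) * s ^ m = (∑' m, f m * s ^ m) * ∑' m, g m * s ^ m := by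
  have hfg : Summable fun x : ℕ × ℕ => (fun m => f m * s ^ m) x.1 * (fun m => g m * s ^ m) x.2 :=
    hfs.mul_of_nonneg hgs (fun m => mul_nonneg (hf m) (pow_nonneg hs m)) (fun m => mul_nonneg (hg m) (pow_nonneg hs m))
  have h1 := summable_sum_mul_antidiagonal_of_summable_mul (f := fun m => f m * s ^ m) (g := fun m => g m * s ^ m) hfg
  have h2 := hfs.tsum_mul_tsum_eq_tsum_sum_antidiagonal hgs hfg
  have hterm : ∀ m, ∑ p ∈ antidiagonal m, f p.1 * s ^ p.1 * (g p.2 * s ^ p.2) =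
      (∑ p ∈ antidiagonal m, f p.1 * g p.2) * s ^ m := fun m => by
    rw [sum_mul]
    refine sum_congr rfl fun p hp => ?_
    have hp' : p.1 + p.2 = m := HasAntidiagonal.mem_antidiagonal.mp hp
    rw [← hp', pow_add]; ring
  simp only [hterm] at h1 h2
  exact ⟨h1, h2.symm⟩

variable {s : ℝ}

/-- ★★ **The derived renewal equation of the generating functions** (`T ≥ 2`, `0 ≤ s < 1`): with
`Ĉ_D(s)_{ab} = Σ_n C_D(n)_{ab}(y_T) s^n` and `Ĉ_M(s)` likewise,
`Ĉ_D(s) = Ĉ_M(s) + Ĉ_M(s) · D_T(s) + I_T(s) · Ĉ_D(s)` (Cauchy products of `contact_ren`).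
[cite: DuminilCopinHammond2013, §2.2; Feller1968, XIII.3; lane «pcv-sawmu» a-p2 g23 — own] -/
theorem contactGF_ren (hT : 2 ≤ T) (hs0 : 0 ≤ s) (hs1 : s < 1) :
    (Matrix.of fun a b : Fin (2 * T) =>
        ∑' n : ℕ, (∑ l ∈ LUset T n (n : ℤ) (a : ℕ) (b : ℕ), (topCnt T l.tail : ℝ) * wD T (stripYT T) l) * s ^ n) =
      (Matrix.of fun a b : Fin (2 * T) =>
          ∑' n : ℕ, (∑ l ∈ LMset T n (n : ℤ) (a : ℕ) (b : ℕ), (topCnt T l.tail : ℝ) * wD T (stripYT T) l) * s ^ n) +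
        (Matrix.of fun a b : Fin (2 * T) =>
            ∑' n : ℕ, (∑ l ∈ LMset T n (n : ℤ) (a : ℕ) (b : ℕ), (topCnt T l.tail : ℝ) * wD T (stripYT T) l) * s ^ n) *
          stripLenD T s +
        stripLenI T s *
          (Matrix.of fun a b : Fin (2 * T) =>
            ∑' n : ℕ, (∑ l ∈ LUset T n (n : ℤ) (a : ℕ) (b : ℕ), (topCnt T l.tail : ℝ) * wD T (stripYT T) l) * s ^ n) := by
  have hT1 : 1 ≤ T := by omega
  have hyT : 0 < stripYT T := stripYT_pos hT1
  have hy := hyT.le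
  ext a b
  simp only [Matrix.add_apply, Matrix.mul_apply, Matrix.of_apply, stripLenD, stripLenI]
  -- abbreviations
  set CU : ℕ → Fin (2 * T) → Fin (2 * T) → ℝ := fun n c d =>
    ∑ l ∈ LUset T n (n : ℤ) (c : ℕ) (d : ℕ), (topCnt T l.tail : ℝ) * wD T (stripYT T) l with hCU
  set CM : ℕ → Fin (2 * T) → Fin (2 * T) → ℝ := fun n c d =>
    ∑ l ∈ LMset T n (n : ℤ) (c : ℕ) (d : ℕ), (topCnt T l.tail : ℝ) * wD T (stripYT T) l with hCM
  have hb := fun n c d => contactSlice_le (T := T) hy n c d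
  have hsum := fun c d => summable_contactSlices hT c d hs0 hs1
  -- the two Cauchy products per intermediate level `c`
  have hc1 : ∀ c : Fin (2 * T),
      (∑' n : ℕ, CM n a c * s ^ n) * (∑' n : ℕ, LUM T n (n : ℤ) (stripYT T) c b * s ^ n) =
        ∑' m : ℕ, (∑ p ∈ antidiagonal m, CM p.1 a c * LUM T p.2 (p.2 : ℤ) (stripYT T) c b) * s ^ m ∧
      Summable (fun m : ℕ => (∑ p ∈ antidiagonal m, CM p.1 a c * LUM T p.2 (p.2 : ℤ) (stripYT T) c b) * s ^ m) := fun c => by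
    obtain ⟨h1, h2⟩ := tsum_antidiagonal_mul_pow₃ (fun n => (hb n a c).2.1) (fun n => (LMM_LUM_nonneg hy _ c b).2) hs0
      (hsum a c).2.1 (lenSlices_basic hT1 c b hs0 hs1).2.1
    exact ⟨h2.symm, h1⟩
  have hc2 : ∀ c : Fin (2 * T),
      (∑' n : ℕ, LMM T n (n : ℤ) (stripYT T) a c * s ^ n) * (∑' n : ℕ, CU n c b * s ^ n) =
        ∑' m : ℕ, (∑ p ∈ antidiagonal m, LMM T p.1 (p.1 : ℤ) (stripYT T) a c * CU p.2 c b) * s ^ m ∧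
      Summable (fun m : ℕ => (∑ p ∈ antidiagonal m, LMM T p.1 (p.1 : ℤ) (stripYT T) a c * CU p.2 c b) * s ^ m) := fun c => by
    obtain ⟨h1, h2⟩ := tsum_antidiagonal_mul_pow₃ (fun n => (LMM_LUM_nonneg hy _ a c).1) (fun n => (hb n c b).1.1) hs0
      (lenSlices_basic hT1 a c hs0 hs1).2.2 (hsum c b).1
    exact ⟨h2.symm, h1⟩
  change ∑' n : ℕ, CU n a b * s ^ n = ∑' n : ℕ, CM n a b * s ^ n +
    ∑ c, (∑' n : ℕ, CM n a c * s ^ n) * (∑' n : ℕ, LUM T n (n : ℤ) (stripYT T) c b * s ^ n) +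
    ∑ c, (∑' n : ℕ, LMM T n (n : ℤ) (stripYT T) a c * s ^ n) * (∑' n : ℕ, CU n c b * s ^ n)
  simp_rw [fun c => (hc1 c).1, fun c => (hc2 c).1]
  rw [← Summable.tsum_finsetSum (fun c _ => (hc1 c).2), ← Summable.tsum_finsetSum (fun c _ => (hc2 c).2),
    ← (hsum a b).2.1.tsum_add (summable_sum fun c _ => (hc1 c).2),
    ← ((hsum a b).2.1.add (summable_sum fun c _ => (hc1 c).2)).tsum_add (summable_sum fun c _ => (hc2 c).2)]
  refine tsum_congr fun n => ?_
  have hren := contact_ren (T := T) hyT n a b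
  change CU n a b = CM n a b + ∑ p ∈ antidiagonal n, ∑ c : Fin (2 * T),
    (CM p.1 a c * LUM T p.2 (p.2 : ℤ) (stripYT T) c b + LMM T p.1 (p.1 : ℤ) (stripYT T) a c * CU p.2 c b) at hren
  rw [hren, add_mul, add_assoc]
  congr 1
  rw [← sum_mul, ← sum_mul, ← add_mul]
  congr 1
  rw [← sum_add_distrib, sum_comm]
  exact sum_congr rfl fun c _ => sum_add_distrib

/-- ★★ **The sandwich**: `Ĉ_D(s) = (1 + D_T(s)) · Ĉ_M(s) · (1 + D_T(s))` for `0 ≤ s < 1` (`T ≥ 2`) — from the derived renewal equation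
`(1 − I_T)Ĉ_D = Ĉ_M(1 + D_T)` and `(1 + D_T)(1 − I_T) = 1` (the tree's Neumann identity `Σ_k I_T^k = 1 + D_T`): the generating function of
«bridges weighted by their number of contacts» is «bridge · (contact-marked irreducible piece) · bridge» — the derivative of `(1 − I)⁻¹`.
[cite: DuminilCopinHammond2013, §2.2; Seneta1973, §6.1 (the resolvent series); lane «pcv-sawmu» a-p2 g23 — own] -/
theorem contactGF_eq_sandwich (hT : 2 ≤ T) (hs0 : 0 ≤ s) (hs1 : s < 1) :
    (Matrix.of fun a b : Fin (2 * T) =>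
        ∑' n : ℕ, (∑ l ∈ LUset T n (n : ℤ) (a : ℕ) (b : ℕ), (topCnt T l.tail : ℝ) * wD T (stripYT T) l) * s ^ n) =
      (1 + stripLenD T s) *
        (Matrix.of fun a b : Fin (2 * T) =>
          ∑' n : ℕ, (∑ l ∈ LMset T n (n : ℤ) (a : ℕ) (b : ℕ), (topCnt T l.tail : ℝ) * wD T (stripYT T) l) * s ^ n) *
        (1 + stripLenD T s) := by
  have hT1 : 1 ≤ T := by omega
  set CU := (Matrix.of fun a b : Fin (2 * T) =>
    ∑' n : ℕ, (∑ l ∈ LUset T n (n : ℤ) (a : ℕ) (b : ℕ), (topCnt T l.tail : ℝ) * wD T (stripYT T) l) * s ^ n) with hCU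
  set CM := (Matrix.of fun a b : Fin (2 * T) =>
    ∑' n : ℕ, (∑ l ∈ LMset T n (n : ℤ) (a : ℕ) (b : ℕ), (topCnt T l.tail : ℝ) * wD T (stripYT T) l) * s ^ n) with hCM
  have hren : CU = CM + CM * stripLenD T s + stripLenI T s * CU := contactGF_ren hT hs0 hs1
  have hsum := summable_pow_stripLenI hT1 hs0 hs1 (T := T)
  have hS : neumannSum (stripLenI T s) = 1 + stripLenD T s := neumannSum_stripLenI_eq hT1 hs0 hs1
  have hSinv : (1 + stripLenD T s) * (1 - stripLenI T s) = 1 := by rw [← hS]; exact neumannSum_mul_one_sub hsum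
  -- `(1 − I) CU = CM (1 + D)`
  have h1 : (1 - stripLenI T s) * CU = CM * (1 + stripLenD T s) := by
    rw [Matrix.sub_mul, Matrix.one_mul, Matrix.mul_add, Matrix.mul_one, sub_eq_iff_eq_add]
    exact hren
  calc CU = ((1 + stripLenD T s) * (1 - stripLenI T s)) * CU := by rw [hSinv, Matrix.one_mul]
    _ = (1 + stripLenD T s) * ((1 - stripLenI T s) * CU) := by rw [Matrix.mul_assoc]
    _ = (1 + stripLenD T s) * (CM * (1 + stripLenD T s)) := by rw [h1]
    _ = (1 + stripLenD T s) * CM * (1 + stripLenD T s) := by rw [Matrix.mul_assoc]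

end GF

/-! ### §5 The limits as `s ↑ 1`: the renewal–reward law for the contacts of a long critical bridge -/

section Limits

variable {u ℓ : Fin (2 * T) → ℝ}

/-- `Ĉ_M(s)_{ab} → C̄_M := Σ_n C_M(n)_{ab}` as `s ↑ 1` — the contact first moment of the critical irreducible bridges, graded by length
(dominated convergence; `Σ_n C_M(n) < ∞`). [cite: Seneta1973, §6.2; DuminilCopinHammond2013, §2.2; lane plumbing a-p2 g23] -/
theorem tendsto_contactGF_irr (hT : 2 ≤ T) (a b : Fin (2 * T)) :
    Tendsto (fun s : ℝ => ∑' n : ℕ, (∑ l ∈ LMset T n (n : ℤ) (a : ℕ) (b : ℕ), (topCnt T l.tail : ℝ) * wD T (stripYT T) l) * s ^ n)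
      (𝓝[<] 1) (𝓝 (∑' n : ℕ, ∑ l ∈ LMset T n (n : ℤ) (a : ℕ) (b : ℕ), (topCnt T l.tail : ℝ) * wD T (stripYT T) l)) := by
  have hT1 : 1 ≤ T := by omega
  have hy := (stripYT_pos hT1).le
  set CM : ℕ → ℝ := fun n => ∑ l ∈ LMset T n (n : ℤ) (a : ℕ) (b : ℕ), (topCnt T l.tail : ℝ) * wD T (stripYT T) l with hCM
  have h0 : ∀ n, 0 ≤ CM n := fun n => (contactSlice_le (T := T) hy n a b).2.1
  have hs : Summable CM := (summable_contactSlices hT a b le_rfl zero_lt_one).2.2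
  exact tendsto_tsum_of_dominated_convergence (𝓕 := 𝓝[<] (1 : ℝ)) (f := fun (s : ℝ) (n : ℕ) => CM n * s ^ n)
    (g := CM) (bound := CM) hs
    (fun n => by
      have : Tendsto (fun s : ℝ => CM n * s ^ n) (𝓝 1) (𝓝 (CM n * 1 ^ n)) := ((continuous_pow n).tendsto 1).const_mul _
      rw [one_pow, mul_one] at this
      exact this.mono_left nhdsWithin_le_nhds)
    (by
      filter_upwards [Ico_mem_nhdsLT zero_lt_one] with s hs' n
      rw [Real.norm_eq_abs, abs_of_nonneg (mul_nonneg (h0 n) (pow_nonneg hs'.1 _))]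
      exact mul_le_of_le_one_right (h0 n) (pow_le_one₀ hs'.1 hs'.2.le))

/-- `(1 − s)·(1 + D_T(s))_{ab} → u_a ℓ_b/⟨ℓ, M̄_len u⟩` as `s ↑ 1` — the explicit length residue of «AMPLITUDE-RATIO» (the `1` carries no mass).
[cite: Seneta1973, §6.2; DuminilCopinHammond2013, §2.2; lane plumbing a-p2 g23] -/
theorem tendsto_one_sub_mul_one_add_stripLenD (hT : 2 ≤ T) (hu0 : ∀ a, 0 < u a) (hℓ0 : ∀ b, 0 < ℓ b)
    (hu : Iinf T (stripYT T) *ᵥ u = u) (hℓ : ℓ ᵥ* Iinf T (stripYT T) = ℓ) (a b : Fin (2 * T)) :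
    Tendsto (fun s : ℝ => (1 - s) * (1 + stripLenD T s) a b) (𝓝[<] 1)
      (𝓝 (u a * ℓ b / (ℓ ⬝ᵥ ((Matrix.of fun a b : Fin (2 * T) => ∑' n : ℕ, (n : ℝ) * LMM T n (n : ℤ) (stripYT T) a b) *ᵥ u)))) := by
  obtain ⟨-, hL⟩ := tendsto_stripLenD_residue_explicit hT hu0 hℓ0 hu hℓ
  have h0 : Tendsto (fun s : ℝ => (1 - s) * (1 : Matrix (Fin (2 * T)) (Fin (2 * T)) ℝ) a b) (𝓝[<] 1) (𝓝 0) := by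
    have : Tendsto (fun s : ℝ => (1 - s) * (1 : Matrix (Fin (2 * T)) (Fin (2 * T)) ℝ) a b) (𝓝 1)
        (𝓝 ((1 - 1) * (1 : Matrix (Fin (2 * T)) (Fin (2 * T)) ℝ) a b)) := (tendsto_const_nhds.sub tendsto_id).mul_const _
    rw [sub_self, zero_mul] at this
    exact this.mono_left nhdsWithin_le_nhds
  have := h0.add (hL a b)
  rw [zero_add] at this
  refine this.congr fun s => ?_
  rw [Matrix.add_apply, mul_add]

/-- ★★★ **THE SECOND-ORDER SINGULARITY OF THE CONTACT-WEIGHTED BRIDGE SERIES** (`T ≥ 2`): for any positive right/left fixed vectors `u`, `ℓ`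
of `Iinf T y_T` and all levels `a, b`,
`(1 − s)² · Ĉ_D(s)_{ab} ⟶ u_a ℓ_b · ⟨ℓ, C̄_M u⟩ / ⟨ℓ, M̄_len u⟩²` as `s ↑ 1`,
where `Ĉ_D(s)_{ab} = Σ_n s^n Σ_{bridges a→b, n steps} #top · x_c^n y_T^{#top}` and `C̄_M = Σ_n C_M(n)` is the contact first-moment matrix of
the irreducible bridges: a DOUBLE pole with an explicit rank-one coefficient (the sandwich `(1 + D_T) Ĉ_M (1 + D_T)`, each bracket a simple pole).
[cite: Seneta1973, §6.2; Feller1968, XIII.11; DuminilCopinHammond2013, §2.2; lane «pcv-sawmu» a-p2 g23 — own result] -/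
theorem tendsto_sq_mul_contactGF (hT : 2 ≤ T) (hu0 : ∀ a, 0 < u a) (hℓ0 : ∀ b, 0 < ℓ b)
    (hu : Iinf T (stripYT T) *ᵥ u = u) (hℓ : ℓ ᵥ* Iinf T (stripYT T) = ℓ) (a b : Fin (2 * T)) :
    Tendsto (fun s : ℝ => (1 - s) ^ 2 *
        ∑' n : ℕ, (∑ l ∈ LUset T n (n : ℤ) (a : ℕ) (b : ℕ), (topCnt T l.tail : ℝ) * wD T (stripYT T) l) * s ^ n) (𝓝[<] 1)
      (𝓝 (u a * ℓ b *
          (ℓ ⬝ᵥ ((Matrix.of fun c d : Fin (2 * T) =>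
              ∑' n : ℕ, ∑ l ∈ LMset T n (n : ℤ) (c : ℕ) (d : ℕ), (topCnt T l.tail : ℝ) * wD T (stripYT T) l) *ᵥ u)) /
        (ℓ ⬝ᵥ ((Matrix.of fun a b : Fin (2 * T) => ∑' n : ℕ, (n : ℝ) * LMM T n (n : ℤ) (stripYT T) a b) *ᵥ u)) ^ 2)) := by
  set dl := ℓ ⬝ᵥ ((Matrix.of fun a b : Fin (2 * T) => ∑' n : ℕ, (n : ℝ) * LMM T n (n : ℤ) (stripYT T) a b) *ᵥ u) with hdl
  set CM1 : Fin (2 * T) → Fin (2 * T) → ℝ := fun c d =>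
    ∑' n : ℕ, ∑ l ∈ LMset T n (n : ℤ) (c : ℕ) (d : ℕ), (topCnt T l.tail : ℝ) * wD T (stripYT T) l with hCM1
  have hS := fun c d => tendsto_one_sub_mul_one_add_stripLenD hT hu0 hℓ0 hu hℓ c d
  have hC := fun c d => tendsto_contactGF_irr hT c d
  -- the sandwich entry `(a,b)`, multiplied by `(1 − s)²`, converges termwise
  have hlim : Tendsto (fun s : ℝ => ∑ d : Fin (2 * T), (∑ c : Fin (2 * T), ((1 - s) * (1 + stripLenD T s) a c) *
      (∑' n : ℕ, (∑ l ∈ LMset T n (n : ℤ) (c : ℕ) (d : ℕ), (topCnt T l.tail : ℝ) * wD T (stripYT T) l) * s ^ n)) *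
      ((1 - s) * (1 + stripLenD T s) d b)) (𝓝[<] 1)
      (𝓝 (∑ d : Fin (2 * T), (∑ c : Fin (2 * T), (u a * ℓ c / dl) * CM1 c d) * (u d * ℓ b / dl))) :=
    tendsto_finsetSum _ fun d _ => (tendsto_finsetSum _ fun c _ => (hS a c).mul (hC c d)).mul (hS d b)
  have hval : ∑ d : Fin (2 * T), (∑ c : Fin (2 * T), (u a * ℓ c / dl) * CM1 c d) * (u d * ℓ b / dl) =
      u a * ℓ b * (ℓ ⬝ᵥ ((Matrix.of CM1) *ᵥ u)) / dl ^ 2 := by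
    simp only [Matrix.mulVec, dotProduct, Matrix.of_apply, mul_sum, sum_mul, Finset.sum_div]
    rw [sum_comm]
    exact sum_congr rfl fun d _ => sum_congr rfl fun c _ => by ring
  rw [hval] at hlim
  refine hlim.congr' ?_
  filter_upwards [Ico_mem_nhdsLT zero_lt_one] with s hs
  have hsand := congr_fun (congr_fun (contactGF_eq_sandwich hT hs.1 hs.2 (T := T)) a) b
  rw [Matrix.mul_apply] at hsand
  simp only [Matrix.mul_apply, Matrix.of_apply] at hsand
  rw [hsand, Finset.mul_sum]
  refine sum_congr rfl fun d _ => ?_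
  rw [Finset.sum_mul, Finset.sum_mul, Finset.mul_sum]
  exact sum_congr rfl fun c _ => by ring

/-- ★★★★ **THE RENEWAL–REWARD LAW FOR THE CONTACTS OF A LONG CRITICAL BRIDGE (Abelian form)** (`T ≥ 2`): for all levels `a, b`,
`(1 − s) · Ĉ_D(s)_{ab} / D_T(s)_{ab} ⟶ θ_T := ⟨ℓ, C̄_M u⟩ / ⟨ℓ, M̄_len u⟩` as `s ↑ 1`,
the SAME for every pair of levels: the Abel-averaged «number of surface contacts per step» of the critical bridges `a → b` weighted by
`x_c^n y_T^{#top} s^n` tends, as the length weight `s ↑ 1`, to (mean contacts of ONE irreducible piece)/(mean steps of ONE irreducible piece)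
under the invariant weighting `π(ω) ∝ ℓ_{start} x_c^{|ω|} y_T^{#top} u_{end}` — the renewal–reward theorem for the strip's Markov renewal structure,
and the physical meaning of the ratio `Λℓ_T/(2Λ_T) = y_T κ_T` of «AMPLITUDE-RATIO» (`C̄_M = y_T M̄_top` is the same first moment in the other
grading).  (If `c̄(n)` = mean contacts of the bridges of length `n`, then `c̄(n) ~ θ_T n` in the Abel sense: `Σ c̄(n)D(n)s^n / Σ D(n)s^n ~ θ_T/(1−s)`.)
[cite: Feller1968, XIII.11; Seneta1973, §6.2; DuminilCopinHammond2013, §2.2; BeatonBousquetMelouDeGierDuminilCopinGuttmann2014, Corollary 8 (arXiv v5 p. 12); lane «pcv-sawmu» a-p2 g23 — own result] -/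
theorem tendsto_contacts_per_step (hT : 2 ≤ T) (hu0 : ∀ a, 0 < u a) (hℓ0 : ∀ b, 0 < ℓ b)
    (hu : Iinf T (stripYT T) *ᵥ u = u) (hℓ : ℓ ᵥ* Iinf T (stripYT T) = ℓ) (a b : Fin (2 * T)) :
    Tendsto (fun s : ℝ => (1 - s) *
        (∑' n : ℕ, (∑ l ∈ LUset T n (n : ℤ) (a : ℕ) (b : ℕ), (topCnt T l.tail : ℝ) * wD T (stripYT T) l) * s ^ n) /
          stripLenD T s a b) (𝓝[<] 1)
      (𝓝 ((ℓ ⬝ᵥ ((Matrix.of fun c d : Fin (2 * T) =>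
              ∑' n : ℕ, ∑ l ∈ LMset T n (n : ℤ) (c : ℕ) (d : ℕ), (topCnt T l.tail : ℝ) * wD T (stripYT T) l) *ᵥ u)) /
        (ℓ ⬝ᵥ ((Matrix.of fun a b : Fin (2 * T) => ∑' n : ℕ, (n : ℝ) * LMM T n (n : ℤ) (stripYT T) a b) *ᵥ u)))) := by
  obtain ⟨hl, hL⟩ := tendsto_stripLenD_residue_explicit hT hu0 hℓ0 hu hℓ
  have h2 := tendsto_sq_mul_contactGF hT hu0 hℓ0 hu hℓ a b
  set dl := ℓ ⬝ᵥ ((Matrix.of fun a b : Fin (2 * T) => ∑' n : ℕ, (n : ℝ) * LMM T n (n : ℤ) (stripYT T) a b) *ᵥ u)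
  set X := ℓ ⬝ᵥ ((Matrix.of fun c d : Fin (2 * T) =>
    ∑' n : ℕ, ∑ l ∈ LMset T n (n : ℤ) (c : ℕ) (d : ℕ), (topCnt T l.tail : ℝ) * wD T (stripYT T) l) *ᵥ u)
  have hne : u a * ℓ b / dl ≠ 0 := (div_pos (mul_pos (hu0 a) (hℓ0 b)) hl).ne'
  have hq := h2.div (hL a b) hne
  have hval : u a * ℓ b * X / dl ^ 2 / (u a * ℓ b / dl) = X / dl := by
    have hua : u a ≠ 0 := (hu0 a).ne'
    have hlb : ℓ b ≠ 0 := (hℓ0 b).ne'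
    field_simp
  rw [hval] at hq
  refine hq.congr' ?_
  filter_upwards [self_mem_nhdsWithin] with s hs
  have hs1 : (1 : ℝ) - s ≠ 0 := sub_ne_zero.2 (ne_of_gt hs)
  rw [Pi.div_apply]
  field_simp

end Limits

/-! ### §6 The contact first moment in the two gradings: `C̄_M = y_T · M̄_top`; hence `θ_T = y_T κ_T` and `Λℓ_T = 2 Λ_T θ_T` -/

section Identification

variable {u ℓ : Fin (2 * T) → ℝ}

/-- ★★ **One first moment, two gradings**: `Σ_n C_M(n)_{ab} = y_T · Σ_j j m_{ab}(j) y_T^{j−1}` (`T ≥ 2`) — summing «contacts × weight» over the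
critical irreducible bridges by LENGTH (left) or by NUMBER OF CONTACTS (right, `m(j) = irCoeff T j`) gives the same number: for each truncation
`N` both sides are `y ∂_y` of the polynomial `Imat T N y` (the tree's `Imat_eq_sum_range_LMM` / `Imat_eq_sum_irCoeffN`), and `N → ∞` by monotone /
dominated convergence. [cite: DuminilCopinHammond2013, §2.2; Seneta1973, §6.2 Theorem 6.4; lane «pcv-sawmu» a-p2 g23 — own] -/
theorem tsum_contactIrr_eq (hT : 2 ≤ T) (a b : Fin (2 * T)) :
    ∑' n : ℕ, ∑ l ∈ LMset T n (n : ℤ) (a : ℕ) (b : ℕ), (topCnt T l.tail : ℝ) * wD T (stripYT T) l =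
      stripYT T * ∑' j : ℕ, (j : ℝ) * irCoeff T j a b * stripYT T ^ (j - 1) := by
  have hT1 : 1 ≤ T := by omega
  have hyT : 0 < stripYT T := stripYT_pos hT1
  have hy := hyT.le
  set CM : ℕ → ℝ := fun n => ∑ l ∈ LMset T n (n : ℤ) (a : ℕ) (b : ℕ), (topCnt T l.tail : ℝ) * wD T (stripYT T) l with hCM
  -- (1) for every truncation `N`: `Σ_{n ≤ N} C_M(n)(y_T) = Σ_{j ≤ N} j · m^{(N)}(j) · y_T^j`
  have hN : ∀ N : ℕ, ∑ n ∈ range (N + 1), CM n = ∑ j ∈ range (N + 1), (j : ℝ) * irCoeffN T N j (a : ℕ) (b : ℕ) * stripYT T ^ j := by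
    intro N
    -- derivative of `y ↦ Imat T N y a b` computed both ways
    have h1 : HasDerivAt (fun y => ∑ n ∈ range (N + 1), LMM T n (n : ℤ) y a b)
        (∑ n ∈ range (N + 1), ∑ l ∈ LMset T n (n : ℤ) (a : ℕ) (b : ℕ),
          hexCriticalFugacity ^ (l.length - 1) * ((topCnt T l.tail : ℝ) * stripYT T ^ (topCnt T l.tail - 1))) (stripYT T) :=
      HasDerivAt.fun_sum fun n _ => hasDerivAt_LMs (T := T) n n _ _ _
    have h2 : HasDerivAt (fun y => ∑ j ∈ range (N + 1), irCoeffN T N j (a : ℕ) (b : ℕ) * y ^ j)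
        (∑ j ∈ range (N + 1), irCoeffN T N j (a : ℕ) (b : ℕ) * ((j : ℝ) * stripYT T ^ (j - 1))) (stripYT T) :=
      HasDerivAt.fun_sum fun j _ => (hasDerivAt_pow j _).const_mul _
    have hfun : (fun y => ∑ n ∈ range (N + 1), LMM T n (n : ℤ) y a b) =
        fun y => ∑ j ∈ range (N + 1), irCoeffN T N j (a : ℕ) (b : ℕ) * y ^ j := by
      funext y; rw [← Imat_eq_sum_range_LMM, Imat_eq_sum_irCoeffN]
    rw [hfun] at h1
    have heq := h1.unique h2
    -- multiply by `y_T`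
    have hl : stripYT T * ∑ n ∈ range (N + 1), ∑ l ∈ LMset T n (n : ℤ) (a : ℕ) (b : ℕ),
        hexCriticalFugacity ^ (l.length - 1) * ((topCnt T l.tail : ℝ) * stripYT T ^ (topCnt T l.tail - 1)) =
        ∑ n ∈ range (N + 1), CM n := by
      rw [mul_sum]; exact sum_congr rfl fun n _ => mul_derivSum_eq_contactSum _ _
    have hr : stripYT T * ∑ j ∈ range (N + 1), irCoeffN T N j (a : ℕ) (b : ℕ) * ((j : ℝ) * stripYT T ^ (j - 1)) =
        ∑ j ∈ range (N + 1), (j : ℝ) * irCoeffN T N j (a : ℕ) (b : ℕ) * stripYT T ^ j := by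
      rw [mul_sum]
      refine sum_congr rfl fun j _ => ?_
      calc stripYT T * (irCoeffN T N j (a : ℕ) (b : ℕ) * ((j : ℝ) * stripYT T ^ (j - 1)))
          = irCoeffN T N j (a : ℕ) (b : ℕ) * ((j : ℝ) * stripYT T ^ (j - 1) * stripYT T) := by ring
        _ = _ := by rw [natMul_pow_pred_mul]; ring
    rw [← hl, heq, hr]
  -- (2) `N → ∞` on the left: partial sums of a summable series
  have hsum : Summable CM := (summable_contactSlices hT a b le_rfl zero_lt_one).2.2
  have hleft : Tendsto (fun N : ℕ => ∑ n ∈ range (N + 1), CM n) atTop (𝓝 (∑' n, CM n)) :=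
    (hsum.hasSum.tendsto_sum_nat).comp (tendsto_add_atTop_nat 1)
  -- (3) `N → ∞` on the right: dominated convergence (`m^{(N)}(j) ↑ m(j)`, bound `j m(j) y_T^j` summable)
  obtain ⟨K, hK⟩ := exists_tsum_mul_irCoeff_mul_pow_le hT
  have hbound : Summable fun j : ℕ => (j : ℝ) * irCoeff T j a b * stripYT T ^ j := by
    have := (hK a b).1.mul_left (stripYT T)
    refine this.congr fun j => ?_
    calc stripYT T * ((j : ℝ) * irCoeff T j a b * stripYT T ^ (j - 1))
        = irCoeff T j a b * ((j : ℝ) * stripYT T ^ (j - 1) * stripYT T) := by ring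
      _ = _ := by rw [natMul_pow_pred_mul]; ring
  have hright : Tendsto (fun N : ℕ => ∑' j : ℕ, if j ≤ N then (j : ℝ) * irCoeffN T N j (a : ℕ) (b : ℕ) * stripYT T ^ j else 0)
      atTop (𝓝 (∑' j : ℕ, (j : ℝ) * irCoeff T j a b * stripYT T ^ j)) := by
    refine tendsto_tsum_of_dominated_convergence (𝓕 := atTop)
      (f := fun (N : ℕ) (j : ℕ) => if j ≤ N then (j : ℝ) * irCoeffN T N j (a : ℕ) (b : ℕ) * stripYT T ^ j else 0)
      (g := fun j : ℕ => (j : ℝ) * irCoeff T j a b * stripYT T ^ j)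
      (bound := fun j : ℕ => (j : ℝ) * irCoeff T j a b * stripYT T ^ j) hbound (fun j => ?_) ?_
    · have h := ((tendsto_irCoeffN hT1 j a b).const_mul (j : ℝ)).mul_const (stripYT T ^ j)
      refine h.congr' ?_
      filter_upwards [eventually_ge_atTop j] with N hN
      rw [if_pos hN]
    · refine Eventually.of_forall fun N j => ?_
      have h0 : 0 ≤ (j : ℝ) * irCoeffN T N j (a : ℕ) (b : ℕ) * stripYT T ^ j :=
        mul_nonneg (mul_nonneg (Nat.cast_nonneg _) (irCoeffN_nonneg T N j _ _)) (pow_nonneg hy _)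
      split_ifs with hjN
      · rw [Real.norm_eq_abs, abs_of_nonneg h0]
        exact mul_le_mul_of_nonneg_right (mul_le_mul_of_nonneg_left (irCoeffN_le_irCoeff hT1 N j a b) (Nat.cast_nonneg _))
          (pow_nonneg hy _)
      · rw [norm_zero]
        exact mul_nonneg (mul_nonneg (Nat.cast_nonneg _) (irCoeff_nonneg hT1 j a b)) (pow_nonneg hy _)
  have hright' : Tendsto (fun N : ℕ => ∑ j ∈ range (N + 1), (j : ℝ) * irCoeffN T N j (a : ℕ) (b : ℕ) * stripYT T ^ j)
      atTop (𝓝 (∑' j : ℕ, (j : ℝ) * irCoeff T j a b * stripYT T ^ j)) := by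
    refine hright.congr fun N => ?_
    rw [tsum_eq_sum (s := range (N + 1)) (fun j hj => by rw [mem_range] at hj; rw [if_neg (by omega)])]
    exact sum_congr rfl fun j hj => by rw [mem_range] at hj; rw [if_pos (by omega)]
  -- (4) conclude
  simp_rw [hN] at hleft
  have hlim := tendsto_nhds_unique hleft hright'
  rw [hlim, ← tsum_mul_left]
  refine tsum_congr fun j => ?_
  calc (j : ℝ) * irCoeff T j a b * stripYT T ^ j = irCoeff T j a b * ((j : ℝ) * stripYT T ^ j) := by ring
    _ = irCoeff T j a b * ((j : ℝ) * stripYT T ^ (j - 1) * stripYT T) := by rw [natMul_pow_pred_mul]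
    _ = _ := by ring

/-- ★★ **`θ_T = y_T κ_T`**: `⟨ℓ, C̄_M u⟩ = y_T · ⟨ℓ, M̄_top u⟩` — the renewal–reward ratio of §5 is the conversion factor of «AMPLITUDE-RATIO»
times `y_T`. [cite: Seneta1973, §6.2; DuminilCopinHammond2013, §2.2; lane «pcv-sawmu» a-p2 g23 — own] -/
theorem contactMoment_dotProduct_eq (hT : 2 ≤ T) (u ℓ : Fin (2 * T) → ℝ) :
    ℓ ⬝ᵥ ((Matrix.of fun c d : Fin (2 * T) =>
        ∑' n : ℕ, ∑ l ∈ LMset T n (n : ℤ) (c : ℕ) (d : ℕ), (topCnt T l.tail : ℝ) * wD T (stripYT T) l) *ᵥ u) =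
      stripYT T * (ℓ ⬝ᵥ ((Matrix.of fun a b : Fin (2 * T) => ∑' j : ℕ, (j : ℝ) * irCoeff T j a b * stripYT T ^ (j - 1)) *ᵥ u)) := by
  simp only [Matrix.mulVec, dotProduct, Matrix.of_apply, tsum_contactIrr_eq hT, mul_sum]
  exact sum_congr rfl fun c _ => sum_congr rfl fun d _ => by ring

/-- ★★★ **`Λℓ_T = 2 Λ_T · θ_T`** (`T ≥ 2`): with `Λ` the contact amplitude and `Λℓ` the length amplitude of the β-walks and `u`, `ℓ` any positive
fixed vectors of `Iinf T y_T`,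
`Λℓ · ⟨ℓ, M̄_len u⟩ = 2Λ · ⟨ℓ, C̄_M u⟩`,
i.e. `Λℓ/(2Λ) = θ_T` = (Abel-)mean number of surface contacts per step of a long critical bridge (§5): the ratio of the two amplitudes of
«AMPLITUDE-RATIO» now has its physical meaning.  At `T = 2` the tree gives `θ₂ = (3 − √2)/4` («AMPLITUDE-RATIO-WIDTH-TWO»).
[cite: Feller1968, XIII.11; BeatonBousquetMelouDeGierDuminilCopinGuttmann2014, §3.2 and Corollary 8; DuminilCopinHammond2013, §2.2; lane «pcv-sawmu» a-p2 g23 — own result] -/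
theorem lengthAmplitude_mul_eq_two_mul_contactAmplitude_mul_theta (hT : 2 ≤ T) (hu0 : ∀ a, 0 < u a) (hℓ0 : ∀ b, 0 < ℓ b)
    (hu : Iinf T (stripYT T) *ᵥ u = u) (hℓ : ℓ ᵥ* Iinf T (stripYT T) = ℓ) {Λ Λℓ : ℝ}
    (hΛ : Tendsto (fun m : ℕ => stripBcoeff T m * stripYT T ^ m) atTop (𝓝 Λ))
    (hΛℓ : Tendsto (fun m : ℕ => betaLenSum T (2 * m) (stripYT T)) atTop (𝓝 Λℓ)) :
    Λℓ * (ℓ ⬝ᵥ ((Matrix.of fun a b : Fin (2 * T) => ∑' n : ℕ, (n : ℝ) * LMM T n (n : ℤ) (stripYT T) a b) *ᵥ u)) =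
      2 * Λ * (ℓ ⬝ᵥ ((Matrix.of fun c d : Fin (2 * T) =>
        ∑' n : ℕ, ∑ l ∈ LMset T n (n : ℤ) (c : ℕ) (d : ℕ), (topCnt T l.tail : ℝ) * wD T (stripYT T) l) *ᵥ u)) := by
  rw [contactMoment_dotProduct_eq hT, lengthAmplitude_mul_meanSteps_eq hT hu0 hℓ0 hu hℓ hΛ hΛℓ]

end Identification

/-! ### §7 Vector-free forms: the contact density `θ_T` as a number, and `θ₂ = (3 − √2)/4` -/

section VectorFree

/-- ★★★ **THE CONTACT DENSITY OF LONG CRITICAL BRIDGES, vector-free** (`T ≥ 2`): there is ONE number `θ_T > 0` such that for EVERY pair of levels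
`(1 − s)·Ĉ_D(s)_{ab}/D_T(s)_{ab} → θ_T` as `s ↑ 1`, and for the β-walk amplitudes `Λ` (contacts) and `Λℓ` (length): `Λℓ = 2Λ·θ_T`.
[cite: Feller1968, XIII.11; DuminilCopinHammond2013, §2.2; BeatonBousquetMelouDeGierDuminilCopinGuttmann2014, §3.2 and Corollary 8; lane «pcv-sawmu» a-p2 g23 — own result] -/
theorem exists_contactDensity (hT : 2 ≤ T) :
    ∃ θ : ℝ, 0 < θ ∧
      (∀ a b : Fin (2 * T), Tendsto (fun s : ℝ => (1 - s) *
          (∑' n : ℕ, (∑ l ∈ LUset T n (n : ℤ) (a : ℕ) (b : ℕ), (topCnt T l.tail : ℝ) * wD T (stripYT T) l) * s ^ n) /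
            stripLenD T s a b) (𝓝[<] 1) (𝓝 θ)) ∧
      ∀ Λ Λℓ : ℝ, Tendsto (fun m : ℕ => stripBcoeff T m * stripYT T ^ m) atTop (𝓝 Λ) →
        Tendsto (fun m : ℕ => betaLenSum T (2 * m) (stripYT T)) atTop (𝓝 Λℓ) → Λℓ = 2 * Λ * θ := by
  have hT1 : 1 ≤ T := by omega
  obtain ⟨u, ℓ, hu0, hℓ0, hu, hℓ⟩ := exists_pos_fixed_vectors_Iinf_stripYT hT
  obtain ⟨hl, -⟩ := tendsto_stripLenD_residue_explicit hT hu0 hℓ0 hu hℓ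
  obtain ⟨hc, -⟩ := tendsto_hKernel_residue_explicit hT hu0 hℓ0 hu hℓ
  set dl := ℓ ⬝ᵥ ((Matrix.of fun a b : Fin (2 * T) => ∑' n : ℕ, (n : ℝ) * LMM T n (n : ℤ) (stripYT T) a b) *ᵥ u) with hdl
  set X := ℓ ⬝ᵥ ((Matrix.of fun c d : Fin (2 * T) =>
    ∑' n : ℕ, ∑ l ∈ LMset T n (n : ℤ) (c : ℕ) (d : ℕ), (topCnt T l.tail : ℝ) * wD T (stripYT T) l) *ᵥ u) with hX
  have hXpos : 0 < X := by
    rw [hX, contactMoment_dotProduct_eq hT]; exact mul_pos (stripYT_pos hT1) hc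
  refine ⟨X / dl, div_pos hXpos hl, fun a b => tendsto_contacts_per_step hT hu0 hℓ0 hu hℓ a b, fun Λ Λℓ hΛ hΛℓ => ?_⟩
  have h := lengthAmplitude_mul_eq_two_mul_contactAmplitude_mul_theta hT hu0 hℓ0 hu hℓ hΛ hΛℓ
  rw [← hdl, ← hX] at h
  field_simp
  linarith [h]

/-- ★★★ **WIDTH TWO: `(3 − √2)/4` CONTACTS PER STEP** — for every pair of levels `a, b` of `S₂`, the Abel-mean number of top-level vertices per
step of the critical bridges `a → b` tends to `(3 − √2)/4 = 0.39644…`: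
`(1 − s)·Ĉ_D(s)_{ab}/D_2(s)_{ab} → (3 − √2)/4` as `s ↑ 1` (§5 with «AMPLITUDE-RATIO-WIDTH-TWO» `widthTwo_meanContacts_per_step`).  A closed-form
critical density for the width-two strip at its adsorption threshold `y₂ = (10 + 8√2)/7`.
[cite: BeatonGuttmannJensen2012, §2 (the narrow strip); BeatonBousquetMelouDeGierDuminilCopinGuttmann2014, Corollary 8; DuminilCopinHammond2013, §2.2; Feller1968, XIII.11; lane «pcv-sawmu» a-p2 g23 — own result] -/
theorem widthTwo_contacts_per_step (a b : Fin (2 * 2)) :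
    Tendsto (fun s : ℝ => (1 - s) *
        (∑' n : ℕ, (∑ l ∈ LUset 2 n (n : ℤ) (a : ℕ) (b : ℕ), (topCnt 2 l.tail : ℝ) * wD 2 (stripYT 2) l) * s ^ n) /
          stripLenD 2 s a b) (𝓝[<] 1) (𝓝 ((3 - Real.sqrt 2) / 4)) := by
  obtain ⟨u, ℓ, hu0, hℓ0, hu, hℓ⟩ := exists_pos_fixed_vectors_Iinf_stripYT (T := 2) le_rfl
  obtain ⟨hl, -⟩ := tendsto_stripLenD_residue_explicit (T := 2) le_rfl hu0 hℓ0 hu hℓ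
  have h := tendsto_contacts_per_step (T := 2) le_rfl hu0 hℓ0 hu hℓ a b
  have hX := contactMoment_dotProduct_eq (T := 2) le_rfl u ℓ
  have hW := widthTwo_meanContacts_per_step hu0 hℓ0 hu hℓ
  set dl := ℓ ⬝ᵥ ((Matrix.of fun a b : Fin (2 * 2) => ∑' n : ℕ, (n : ℝ) * LMM 2 n (n : ℤ) (stripYT 2) a b) *ᵥ u)
  set dc := ℓ ⬝ᵥ ((Matrix.of fun a b : Fin (2 * 2) => ∑' j : ℕ, (j : ℝ) * irCoeff 2 j a b * stripYT 2 ^ (j - 1)) *ᵥ u)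
  set X := ℓ ⬝ᵥ ((Matrix.of fun c d : Fin (2 * 2) =>
    ∑' n : ℕ, ∑ l ∈ LMset 2 n (n : ℤ) (c : ℕ) (d : ℕ), (topCnt 2 l.tail : ℝ) * wD 2 (stripYT 2) l) *ᵥ u)
  have hval : X / dl = (3 - Real.sqrt 2) / 4 := by
    rw [div_eq_div_iff hl.ne' (by norm_num : (4 : ℝ) ≠ 0), hX]
    linarith [hW]
  rw [← hval]
  exact h

end VectorFree






end HV

end Literature.Probability.RandomPlanarGeometry.SAW
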